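import Literature.AlgebraicGeometry.HodgeTheory.RosatiInvolutionAlbertKindTypeIVFactor
import HarnessLib

/-!
# A central number field `K ⊆ End⁰(B)` of a simple complex abelian variety IS the centre `CenterField B`; Moonen–Zarhin's
# Lemma (1) numerics from an Albert datum: type IV over `K` ⟹ the centre of `G_div(X)(h_X)(ℂ)` is a torus
# `(ℂˣ)^{[K:ℚ]/2}`; first kind on `K` (types I–III) ⟹ an elementary abelian `2`-group of order `≤ 2^{[K:ℚ]}`

Layer `Literature/AlgebraicGeometry/HodgeTheory`; THEOREMS ONLY — no definition, no instance, no named fact, no `sorry`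
(D-0026, net debt 0).  Lane `lit-hodgefound` (Track 2, Layer A), prover seat `lit-hodgefound-p21`, generation 28, row
g28-#8; sequel of `RosatiInvolutionAlbertKindTypeIVFactor` (g28-#6, the Albert-vocabulary bridge) and of the seat's
`DivisorLefschetzGroupCentreLemmaOneIntrinsic` / `DivisorLefschetzGroupCentreFiniteIntrinsic` (g28-#3/#1: Lemma (1) of
[MoonenZarhin1998WeilClasses] for `X ∼ B^m`, `m ≥ 2`, with `e = [E:ℚ]`, `e₀` read on the tree's `CenterField B`).
The Albert data of the tree (`IsAlbertTypeI…IV K End⁰(B) ι`, `RingTheory/CentralSimple/AlbertTypes`) carry the centre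
as an ABSTRACT number field `K` with `[Algebra K End⁰(B)]`; this file identifies such a `K` with `CenterField B` and
re-keys the numerics of Lemma (1) by `[K:ℚ]`.

## The print

B. Moonen, Yu. Zarhin, *Weil classes on abelian varieties*, J. reine angew. Math. **496** (1998) 83–92
[MoonenZarhin1998WeilClasses] (held `paper:arxiv-alg-geom_9612017`), §1 (p0002 L45–L51): «Let `D = End⁰(Y)`, let `E`
be the center of `D`, and let `E₀` be the maximal totally real subfield of `E`. We write `e₀ = [E₀:ℚ]`, `e = [E:ℚ]` …»;
Lemma (1) (p0002 L121–L127): «… For `X` of type 4 with either `d ≥ 2` or `m ≥ 2` this is a connected torus of rank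
`e₀`; in all other cases it is finite.»  H. Lange [Lange2023AbelianVarietiesComplex] §2.6.1 (p0137: «Let `K` denote
the centre of the skew field `F` … `[K:ℚ] = e`», table p0138 «`e₀ = e` / `e₀ = ½e`»), §2.6.2 Lemma 2.6.4, Thm. 2.6.5,
Lemma 2.6.6.  D. Mumford [MumfordAV1970] §21 Thm. 2 (the invariants `e`, `e₀`, `d` of the four types).

## What is proved (sorry-free)

`B` simple of positive dimension, `K` a number field with `[Algebra K End⁰(B)] [IsScalarTower ℚ K End⁰(B)]
[Algebra.IsCentral K End⁰(B)]`, `ψ` any polarization of `H¹(B(ℂ); ℚ)`, `ros = AbelianVariety.rosati B … ψ`.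

§1 `K` IS THE CENTRE:
* **`IsSimple.nonempty_algEquiv_centerField_of_isCentral`** — `K ≃ₐ[ℚ] CenterField B`, with
  `IsSimple.exists_ringEquiv_centerField_val_comp_eq_algebraMap` (the isomorphism commutes with the two embeddings
  into `End⁰(B)`); **`IsSimple.finrank_eq_finrank_centerField_of_isCentral`** — `[K:ℚ] = e`;
  `IsSimple.isTotallyReal_iff_isTotallyReal_centerField_of_isCentral`, `IsSimple.isCMField_iff_isCMField_centerField_of_isCentral`.
§2 LEMMA (1) NUMERICS FROM AN ALBERT DATUM (`X ∼ B^m`, `m ≥ 2`, `h_X` an admissible class):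
* **`IsSimple.exists_center_divisorLefschetzGroup_mulEquiv_pi_units_of_isAlbertTypeIV_rosati`** — type IV over `K`:
  `Z(G_div(X)(h_X))(ℂ) ≃ (ℂˣ)^{e₀}` with `2 e₀ = [K:ℚ]`; `…_of_isCMField_of_isCentral` (keyed by `IsCMField K`);
* **`IsSimple.center_divisorLefschetzGroup_involutive_finite_card_le_of_isOfFirstKind_rosati`** — first kind on `K`:
  every central element squares to `1`, the centre is finite of order `≤ 2^{[K:ℚ]}`; `…_of_isTotallyReal_of_isCentral`,
  `…_of_isAlbertTypeI_rosati`, `…_of_isAlbertTypeII_rosati`, `…_of_isAlbertTypeIII_rosati`.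

## Honest column

* The rank statement is `e₀ = [K:ℚ]/2` for the CM field `K` (Lange's table «`e₀ = ½ e`»); that `e₀ = [K₀:ℚ]` for the
  maximal totally real subfield `K₀` is Mathlib's `IsCMField` degree-two fact and is not restated.
* `X ∼ B^m` with `m ≥ 2` as in the seat's Lemma (1) files; the case `m = 1`, `d ≥ 2` of the print is not covered there
  and hence not here.

## References

* [MoonenZarhin1998WeilClasses] B. Moonen, Yu. Zarhin, J. reine angew. Math. 496 (1998), §1 (p0002 L45–L51),
  Lemma (1) (p0002 L121–L127). [cite: MoonenZarhin1998WeilClasses, §1 (p0002 L45–L51) and Lemma (1) (p0002 L121–L127)]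
* [Lange2023AbelianVarietiesComplex] H. Lange, *Abelian Varieties over the Complex Numbers* (2023), §2.6.1 (PDF p0137–p0138),
  §2.6.2 Lemma 2.6.4, Thm. 2.6.5 (p0141), Lemma 2.6.6 (p0144). [cite: Lange2023AbelianVarietiesComplex, §2.6.1 (PDF p0137–p0138) and §2.6.2 (p0141, p0144)]
* [MumfordAV1970] D. Mumford, *Abelian Varieties* (1970), §21 Thm. 2. [cite: MumfordAV1970, §21 Thm. 2]
-/

noncomputable section

namespace Literature.AlgebraicGeometry.HodgeTheory

open CategoryTheory Module NumberField
open Literature.AlgebraicGeometry.Motives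
open Literature.AlgebraicGeometry.ComplexMultiplication
open Literature.AlgebraicGeometry.Motives.HodgeStructure
open Literature.RingTheory.CentralSimple
open Literature.NumberTheory.Automorphic (IsQuaternionAlgebra)
open Literature.AlgebraicTopology.SingularHomology

variable {B : AbelianVariety ℂ} {K : Type} [Field K] [NumberField K] [Algebra K B.endAlgebra]
  [IsScalarTower ℚ K B.endAlgebra]

/-! ### §1 A central number field `K ⊆ End⁰(B)` is the centre `CenterField B` -/

section Centre

variable [Algebra.IsCentral K B.endAlgebra]

omit [NumberField K] [IsScalarTower ℚ K B.endAlgebra] in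
/-- A central element of the central `K`-algebra `End⁰(B)` lies in the image of `K`. [folklore] -/
private theorem exists_algebraMap_eq_of_mem_center'' {z : B.endAlgebra} (hz : z ∈ Subalgebra.center ℚ B.endAlgebra) :
    ∃ k : K, algebraMap K B.endAlgebra k = z := by
  have hzK : z ∈ (⊥ : Subalgebra K B.endAlgebra) := by
    rw [← Algebra.IsCentral.center_eq_bot K B.endAlgebra, Subalgebra.mem_center_iff]
    exact fun b => Subalgebra.mem_center_iff.1 hz b
  exact Algebra.mem_bot.1 hzK

omit [NumberField K] [IsScalarTower ℚ K B.endAlgebra] in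
/-- **A central number field `K ⊆ End⁰(B)` of a simple `B` is the centre**: a ring isomorphism `K ≃+* CenterField B`
compatible with the two embeddings into `End⁰(B)` («Let `K` denote the centre of the skew field `F`»).
[cite: Lange2023AbelianVarietiesComplex, §2.6.1 (PDF p0137)] [cite: MoonenZarhin1998WeilClasses, §1 (p0002 L45–L51: `E` the center of `D`)] -/
theorem _root_.Literature.AlgebraicGeometry.Motives.AbelianVariety.IsSimple.exists_ringEquiv_centerField_val_comp_eq_algebraMap
    (hB : AbelianVariety.IsSimple B) (hB0 : 0 < B.dim) :
    ∃ e : K ≃+* CenterField B hB hB0, ∀ k, CenterField.val hB hB0 (e k) = algebraMap K B.endAlgebra k := by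
  haveI := nontrivial_endAlgebra_of_dim_pos hB0
  let f : K → CenterField B hB hB0 := fun k =>
    (show CenterField B hB hB0 from
      ⟨algebraMap K B.endAlgebra k, Subalgebra.mem_center_iff.2 fun y => (Algebra.commutes k y).symm⟩)
  have hf : ∀ k, CenterField.val hB hB0 (f k) = algebraMap K B.endAlgebra k := fun k => rfl
  have hinj := CenterField.val_injective hB hB0
  let g : K →+* CenterField B hB hB0 :=
    { toFun := f
      map_one' := hinj (by rw [hf, map_one, map_one])
      map_mul' := fun x y => hinj (by rw [hf, map_mul, map_mul, hf, hf])
      map_zero' := hinj (by rw [hf, map_zero, map_zero])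
      map_add' := fun x y => hinj (by rw [hf, map_add, map_add, hf, hf]) }
  have hg : ∀ k, CenterField.val hB hB0 (g k) = algebraMap K B.endAlgebra k := hf
  have hbij : Function.Bijective g := by
    refine ⟨g.injective, fun z => ?_⟩
    obtain ⟨k, hk⟩ := exists_algebraMap_eq_of_mem_center'' (K := K) (show Subalgebra.center ℚ B.endAlgebra from z).2
    exact ⟨k, hinj (by rw [hg, hk]; rfl)⟩
  exact ⟨RingEquiv.ofBijective g hbij, hg⟩

omit [IsScalarTower ℚ K B.endAlgebra] in
/-- **`K ≃ₐ[ℚ] CenterField B`** (the ring isomorphism is `ℚ`-linear). [cite: Lange2023AbelianVarietiesComplex, §2.6.1 (PDF p0137)] -/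
theorem _root_.Literature.AlgebraicGeometry.Motives.AbelianVariety.IsSimple.nonempty_algEquiv_centerField_of_isCentral
    (hB : AbelianVariety.IsSimple B) (hB0 : 0 < B.dim) : Nonempty (K ≃ₐ[ℚ] CenterField B hB hB0) := by
  obtain ⟨e, -⟩ := hB.exists_ringEquiv_centerField_val_comp_eq_algebraMap (K := K) hB0
  exact ⟨AlgEquiv.ofRingEquiv (f := e) fun q => by
    rw [eq_ratCast (algebraMap ℚ K) q, map_ratCast, eq_ratCast (algebraMap ℚ (CenterField B hB hB0)) q]⟩

omit [IsScalarTower ℚ K B.endAlgebra] in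
/-- **`[K:ℚ] = e = [E:ℚ]`**: the degree of a central number field `K ⊆ End⁰(B)` is the degree of the centre.
[cite: MoonenZarhin1998WeilClasses, §1 (p0002 L45–L51: `e = [E:ℚ]`)] [cite: Lange2023AbelianVarietiesComplex, §2.6.1 (PDF p0137: `[K:ℚ] = e`)] -/
theorem _root_.Literature.AlgebraicGeometry.Motives.AbelianVariety.IsSimple.finrank_eq_finrank_centerField_of_isCentral
    (hB : AbelianVariety.IsSimple B) (hB0 : 0 < B.dim) :
    Module.finrank ℚ K = Module.finrank ℚ (CenterField B hB hB0) := by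
  obtain ⟨e⟩ := hB.nonempty_algEquiv_centerField_of_isCentral (K := K) hB0
  exact e.toLinearEquiv.finrank_eq

/-- `K` is totally real iff the centre `CenterField B` is (both say: `B` has no factor of type IV).
[cite: Lange2023AbelianVarietiesComplex, §2.6.2 Lemma 2.6.4 and Thm. 2.6.5 (PDF p0141)] [cite: MoonenZarhin1998WeilClasses, §1 (types 1–3)] -/
theorem _root_.Literature.AlgebraicGeometry.Motives.AbelianVariety.IsSimple.isTotallyReal_iff_isTotallyReal_centerField_of_isCentral
    (hB : AbelianVariety.IsSimple B) (hB0 : 0 < B.dim) : IsTotallyReal K ↔ IsTotallyReal (CenterField B hB hB0) := by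
  rw [← AbelianVariety.hasNoTypeIVFactor_iff_isTotallyReal_of_isCentral (A := B) (K := K) hB0,
    hasNoTypeIVFactor_iff_isTotallyReal_centerField hB hB0]

/-- `K` is a CM field iff the centre `CenterField B` is (both say: `B` has a factor of type IV).
[cite: Lange2023AbelianVarietiesComplex, §2.6.2 Lemma 2.6.6 (PDF p0144)] [cite: MoonenZarhin1998WeilClasses, §1 (type 4)] -/
theorem _root_.Literature.AlgebraicGeometry.Motives.AbelianVariety.IsSimple.isCMField_iff_isCMField_centerField_of_isCentral
    (hB : AbelianVariety.IsSimple B) (hB0 : 0 < B.dim) : IsCMField K ↔ IsCMField (CenterField B hB hB0) := by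
  rw [← AbelianVariety.not_hasNoTypeIVFactor_iff_isCMField_of_isCentral (A := B) (K := K) hB0,
    not_hasNoTypeIVFactor_iff_isCMField_centerField hB hB0]

end Centre

/-! ### §2 Moonen–Zarhin 1998 Lemma (1) from an Albert datum: the numerics `e = [K:ℚ]`, `e₀ = [K:ℚ]/2` -/

section LemmaOne

variable {n : ℕ} [Module.Finite ℚ (bettiCohomology B.X 1)]
  (ψ : (BettiUniverse.hodge exists_isReal_hodgeModel_holds (AbelianVariety.isSmoothProjective_holds (A := B)) 1).Polarization)

omit [Module.Finite ℚ (bettiCohomology B.X 1)] in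
/-- **Lemma (1), type 4, keyed by a central CM field `K`**: `B` simple with a central CM number field `K ⊆ End⁰(B)`;
then for `X ∼ B^m`, `m ≥ 2`, and every admissible `h_X` the centre of `G_div(X)(h_X)(ℂ)` is a torus `(ℂˣ)^{e₀}` with
`2 e₀ = [K:ℚ]` («a connected torus of rank `e₀`», `e₀ = ½ e`). [cite: MoonenZarhin1998WeilClasses, §1 Lemma (1) (p0002 L121–L127)]
[cite: Lange2023AbelianVarietiesComplex, §2.6.1 table (PDF p0138: `e₀ = ½ e`)] -/
theorem _root_.Literature.AlgebraicGeometry.Motives.AbelianVariety.IsSimple.exists_center_divisorLefschetzGroup_mulEquiv_pi_units_of_isCMField_of_isCentral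
    [Algebra.IsCentral K B.endAlgebra] (hB : AbelianVariety.IsSimple B) (h1 : 1 ≤ B.dim) (hK : IsCMField K)
    {X : AbelianVariety ℂ} (hX : X.IsIsogenous (⨁ fun _ : Fin (n + 2) => B)) {hX' : complexBetti X.X 2}
    (hhX : hX' ∈ VanGeemen1994.hodgeClassSpan X.dim X.X 1)
    (hndX : ∀ x : complexBetti X.X 1, (∀ y, polarizationPairingOne X.X hX' (X.dim - 1) x y = 0) → x = 0) :
    ∃ e₀ : ℕ, 2 * e₀ = Module.finrank ℚ K ∧
      Nonempty (Subgroup.center (divisorLefschetzGroup X hX') ≃* (Fin e₀ → ℂˣ)) := by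
  rw [hB.finrank_eq_finrank_centerField_of_isCentral (K := K) h1]
  exact hB.exists_center_divisorLefschetzGroup_mulEquiv_pi_units_of_isCMField_centerField h1
    ((hB.isCMField_iff_isCMField_centerField_of_isCentral (K := K) h1).1 hK) hX hhX hndX

/-- **Lemma (1), type 4, FROM AN ALBERT DATUM**: `B` simple whose Rosati pair `(End⁰(B), ros_ψ)` is of Albert type IV over
the number field `K` (`IsAlbertTypeIV K End⁰(B) ros_ψ`); then for `X ∼ B^m`, `m ≥ 2`, and every admissible `h_X`,
`Z(G_div(X)(h_X))(ℂ) ≃ (ℂˣ)^{e₀}` with `2 e₀ = [K:ℚ]`. [cite: MoonenZarhin1998WeilClasses, §1 Lemma (1) (p0002 L121–L127)]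
[cite: Lange2023AbelianVarietiesComplex, §2.6.2 Lemma 2.6.6 and Thm. 2.6.8 (PDF p0144–p0145)] [cite: MumfordAV1970, §21 Thm. 2 (type IV)] -/
theorem _root_.Literature.AlgebraicGeometry.Motives.AbelianVariety.IsSimple.exists_center_divisorLefschetzGroup_mulEquiv_pi_units_of_isAlbertTypeIV_rosati
    (hB : AbelianVariety.IsSimple B) (h1 : 1 ≤ B.dim)
    (hIV : IsAlbertTypeIV K B.endAlgebra
      (AbelianVariety.rosati B exists_isReal_hodgeModel_holds hodgePQ_independent_of_hodgeModel_holds ψ))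
    {X : AbelianVariety ℂ} (hX : X.IsIsogenous (⨁ fun _ : Fin (n + 2) => B)) {hX' : complexBetti X.X 2}
    (hhX : hX' ∈ VanGeemen1994.hodgeClassSpan X.dim X.X 1)
    (hndX : ∀ x : complexBetti X.X 1, (∀ y, polarizationPairingOne X.X hX' (X.dim - 1) x y = 0) → x = 0) :
    ∃ e₀ : ℕ, 2 * e₀ = Module.finrank ℚ K ∧
      Nonempty (Subgroup.center (divisorLefschetzGroup X hX') ≃* (Fin e₀ → ℂˣ)) := by
  haveI := hIV.isCentral
  exact hB.exists_center_divisorLefschetzGroup_mulEquiv_pi_units_of_isCMField_of_isCentral h1 hIV.isCMField hX hhX hndX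

omit [Module.Finite ℚ (bettiCohomology B.X 1)] in
/-- **Lemma (1), types 1–3, keyed by a central totally real `K`**: `B` simple with a central totally real number field
`K ⊆ End⁰(B)`; then for `X ∼ B^m`, `m ≥ 2`, and every admissible `h_X`, every central element of `G_div(X)(h_X)(ℂ)`
squares to `1` and the centre is finite of order `≤ 2^{[K:ℚ]}` («in all other cases it is finite»).
[cite: MoonenZarhin1998WeilClasses, §1 Lemma (1) (p0002 L121–L127)] [cite: Lange2023AbelianVarietiesComplex, §2.6.1 table (PDF p0138: `e₀ = e`)] -/
theorem _root_.Literature.AlgebraicGeometry.Motives.AbelianVariety.IsSimple.center_divisorLefschetzGroup_involutive_finite_card_le_of_isTotallyReal_of_isCentral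
    [Algebra.IsCentral K B.endAlgebra] [IsTotallyReal K] (hB : AbelianVariety.IsSimple B) (h1 : 1 ≤ B.dim)
    {X : AbelianVariety ℂ} (hX : X.IsIsogenous (⨁ fun _ : Fin (n + 2) => B)) {hX' : complexBetti X.X 2}
    (hhX : hX' ∈ VanGeemen1994.hodgeClassSpan X.dim X.X 1)
    (hndX : ∀ x : complexBetti X.X 1, (∀ y, polarizationPairingOne X.X hX' (X.dim - 1) x y = 0) → x = 0) :
    (∀ z ∈ Subgroup.center (divisorLefschetzGroup X hX'), z * z = 1) ∧
      Finite (Subgroup.center (divisorLefschetzGroup X hX')) ∧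
        Nat.card (Subgroup.center (divisorLefschetzGroup X hX')) ≤ 2 ^ Module.finrank ℚ K := by
  rw [hB.finrank_eq_finrank_centerField_of_isCentral (K := K) h1]
  exact hB.center_divisorLefschetzGroup_involutive_finite_card_le_of_hasNoTypeIVFactor h1
    (AbelianVariety.hasNoTypeIVFactor_of_isCentral_of_isTotallyReal (A := B) (K := K)) hX hhX hndX

/-- **Lemma (1), types 1–3, FROM A ROSATI PAIR OF THE FIRST KIND** on a central number field `K ⊆ End⁰(B)` (`B` simple):
for `X ∼ B^m`, `m ≥ 2`, the centre of `G_div(X)(h_X)(ℂ)` is an elementary abelian `2`-group of order `≤ 2^{[K:ℚ]}`.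
[cite: MoonenZarhin1998WeilClasses, §1 Lemma (1) (p0002 L121–L127)] [cite: Lange2023AbelianVarietiesComplex, §2.6.2 (PDF p0141 L21) and Thm. 2.6.5] -/
theorem _root_.Literature.AlgebraicGeometry.Motives.AbelianVariety.IsSimple.center_divisorLefschetzGroup_involutive_finite_card_le_of_isOfFirstKind_rosati
    [Algebra.IsCentral K B.endAlgebra] (hB : AbelianVariety.IsSimple B) (h1 : 1 ≤ B.dim)
    (h1K : IsOfFirstKind K B.endAlgebra
      (AbelianVariety.rosati B exists_isReal_hodgeModel_holds hodgePQ_independent_of_hodgeModel_holds ψ))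
    {X : AbelianVariety ℂ} (hX : X.IsIsogenous (⨁ fun _ : Fin (n + 2) => B)) {hX' : complexBetti X.X 2}
    (hhX : hX' ∈ VanGeemen1994.hodgeClassSpan X.dim X.X 1)
    (hndX : ∀ x : complexBetti X.X 1, (∀ y, polarizationPairingOne X.X hX' (X.dim - 1) x y = 0) → x = 0) :
    (∀ z ∈ Subgroup.center (divisorLefschetzGroup X hX'), z * z = 1) ∧
      Finite (Subgroup.center (divisorLefschetzGroup X hX')) ∧
        Nat.card (Subgroup.center (divisorLefschetzGroup X hX')) ≤ 2 ^ Module.finrank ℚ K := by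
  haveI : IsTotallyReal K := (AbelianVariety.isOfFirstKind_rosati_iff_isTotallyReal ψ (K := K) h1).1 h1K
  exact hB.center_divisorLefschetzGroup_involutive_finite_card_le_of_isTotallyReal_of_isCentral h1 hX hhX hndX

/-- **Lemma (1) from a Rosati pair of Albert type I** (`End⁰(B) = K` totally real): centre of order `≤ 2^{[K:ℚ]}`.
[cite: MoonenZarhin1998WeilClasses, §1 Lemma (1) (p0002 L121–L127)] [cite: Lange2023AbelianVarietiesComplex, §2.6.2 Thm. 2.6.5 (a) (PDF p0141)] -/
theorem _root_.Literature.AlgebraicGeometry.Motives.AbelianVariety.IsSimple.center_divisorLefschetzGroup_involutive_finite_card_le_of_isAlbertTypeI_rosati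
    (hB : AbelianVariety.IsSimple B) (h1 : 1 ≤ B.dim)
    (hI : IsAlbertTypeI K B.endAlgebra
      (AbelianVariety.rosati B exists_isReal_hodgeModel_holds hodgePQ_independent_of_hodgeModel_holds ψ))
    {X : AbelianVariety ℂ} (hX : X.IsIsogenous (⨁ fun _ : Fin (n + 2) => B)) {hX' : complexBetti X.X 2}
    (hhX : hX' ∈ VanGeemen1994.hodgeClassSpan X.dim X.X 1)
    (hndX : ∀ x : complexBetti X.X 1, (∀ y, polarizationPairingOne X.X hX' (X.dim - 1) x y = 0) → x = 0) :
    (∀ z ∈ Subgroup.center (divisorLefschetzGroup X hX'), z * z = 1) ∧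
      Finite (Subgroup.center (divisorLefschetzGroup X hX')) ∧
        Nat.card (Subgroup.center (divisorLefschetzGroup X hX')) ≤ 2 ^ Module.finrank ℚ K := by
  haveI := nontrivial_endAlgebra_of_dim_pos (B := B) h1
  haveI := hI.isTotallyReal
  -- (`Module K End⁰(B)` is found only through `Algebra.toModule`: the instance is passed explicitly)
  haveI : Module.Free K B.endAlgebra := @Module.Free.of_divisionRing K B.endAlgebra _ _ Algebra.toModule
  haveI : Algebra.IsCentral K B.endAlgebra :=
    ⟨by rw [Subalgebra.bot_eq_top_of_finrank_eq_one hI.finrank_eq_one]; exact le_top⟩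
  exact hB.center_divisorLefschetzGroup_involutive_finite_card_le_of_isTotallyReal_of_isCentral h1 hX hhX hndX

/-- **Lemma (1) from a Rosati pair of Albert type II** (totally indefinite quaternion algebra over a totally real `K`).
[cite: MoonenZarhin1998WeilClasses, §1 Lemma (1) (p0002 L121–L127)] [cite: Lange2023AbelianVarietiesComplex, §2.6.2 Thm. 2.6.5 (b) (PDF p0141)] -/
theorem _root_.Literature.AlgebraicGeometry.Motives.AbelianVariety.IsSimple.center_divisorLefschetzGroup_involutive_finite_card_le_of_isAlbertTypeII_rosati
    (hB : AbelianVariety.IsSimple B) (h1 : 1 ≤ B.dim)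
    (hII : IsAlbertTypeII K B.endAlgebra
      (AbelianVariety.rosati B exists_isReal_hodgeModel_holds hodgePQ_independent_of_hodgeModel_holds ψ))
    {X : AbelianVariety ℂ} (hX : X.IsIsogenous (⨁ fun _ : Fin (n + 2) => B)) {hX' : complexBetti X.X 2}
    (hhX : hX' ∈ VanGeemen1994.hodgeClassSpan X.dim X.X 1)
    (hndX : ∀ x : complexBetti X.X 1, (∀ y, polarizationPairingOne X.X hX' (X.dim - 1) x y = 0) → x = 0) :
    (∀ z ∈ Subgroup.center (divisorLefschetzGroup X hX'), z * z = 1) ∧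
      Finite (Subgroup.center (divisorLefschetzGroup X hX')) ∧
        Nat.card (Subgroup.center (divisorLefschetzGroup X hX')) ≤ 2 ^ Module.finrank ℚ K := by
  haveI := hII.isTotallyReal
  haveI := hII.isQuaternionAlgebra.isCentral
  exact hB.center_divisorLefschetzGroup_involutive_finite_card_le_of_isTotallyReal_of_isCentral h1 hX hhX hndX

/-- **Lemma (1) from a Rosati pair of Albert type III** (totally definite quaternion algebra over a totally real `K`).
[cite: MoonenZarhin1998WeilClasses, §1 Lemma (1) (p0002 L121–L127)] [cite: Lange2023AbelianVarietiesComplex, §2.6.2 Thm. 2.6.5 (c) (PDF p0141)] -/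
theorem _root_.Literature.AlgebraicGeometry.Motives.AbelianVariety.IsSimple.center_divisorLefschetzGroup_involutive_finite_card_le_of_isAlbertTypeIII_rosati
    (hB : AbelianVariety.IsSimple B) (h1 : 1 ≤ B.dim)
    (hIII : IsAlbertTypeIII K B.endAlgebra
      (AbelianVariety.rosati B exists_isReal_hodgeModel_holds hodgePQ_independent_of_hodgeModel_holds ψ))
    {X : AbelianVariety ℂ} (hX : X.IsIsogenous (⨁ fun _ : Fin (n + 2) => B)) {hX' : complexBetti X.X 2}
    (hhX : hX' ∈ VanGeemen1994.hodgeClassSpan X.dim X.X 1)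
    (hndX : ∀ x : complexBetti X.X 1, (∀ y, polarizationPairingOne X.X hX' (X.dim - 1) x y = 0) → x = 0) :
    (∀ z ∈ Subgroup.center (divisorLefschetzGroup X hX'), z * z = 1) ∧
      Finite (Subgroup.center (divisorLefschetzGroup X hX')) ∧
        Nat.card (Subgroup.center (divisorLefschetzGroup X hX')) ≤ 2 ^ Module.finrank ℚ K := by
  haveI := hIII.isTotallyReal
  haveI := hIII.isQuaternionAlgebra.isCentral
  exact hB.center_divisorLefschetzGroup_involutive_finite_card_le_of_isTotallyReal_of_isCentral h1 hX hhX hndX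

end LemmaOne

end Literature.AlgebraicGeometry.HodgeTheory

end
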